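import Literature.AlgebraicGeometry.Resolution.NormalizationInExtension
import Literature.AlgebraicGeometry.Resolution.GenericEtaleSeparable
import Literature.AlgebraicGeometry.Resolution.AlterationsStrong
import Mathlib.AlgebraicGeometry.Morphisms.Etale
import HarnessLib

/-!
# The normalization in a finite separable extension of the function field is generically étale

Topic: `Literature/AlgebraicGeometry/Resolution`. Companion to `NormalizationInExtension.lean`
(`normalizationIn Y L`, `normalizationInι Y L : Y^L → Y`, finite for `Y` a variety and
`L/K(Y)` finite) and `GenericEtaleSeparable.lean` (the ring-theoretic heart of de Jong 1996,
2.20). De Jong 1996, 4.16: "Choose a finite separable Galois extension `k(Y) ⊂ L` […]. Let `Y'`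
be the normalization of `Y` in the field `L`, then `ψ : Y' → Y` is a (finite) generically étale
alteration of `Y`" — by 2.20: "an alteration `S' → S` is generically étale if and only if the
(finite) extension of function fields `R(S) ⊂ R(S')` is separable". Everything here is PROVED:

* `surjective_normalizationInι` — `Y^L → Y` is surjective (integral and dominant);
* `isGenericallyEtale_normalizationInι` — **for `Y` an integral scheme locally of finite type
  over a field and `L/K(Y)` finite separable, `Y^L → Y` is generically étale** (de Jong 1996,
  2.6: étale on a dense open of `Y^L`). Proof: over a non-empty affine open `U = Spec A` of `Y`
  the normalization is `Spec` of the integral closure `C` of `A` in `L`, a finite `A`-module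
  (E. Noether, `NoetherFiniteIntegralClosure_holds`) with fraction field `L`; by
  `exists_etale_localization_away_of_isSeparable_of_finite` some `C[1/c]`, `c ≠ 0`, is étale
  over `A`, and `Spec C[1/c] ⊂ Y^L` is a non-empty, hence dense, open of the irreducible `Y^L`
  on which `ψ` is `Spec C[1/c] → Spec A = U ⊂ Y`, étale;
* `isAlteration_and_isGenericallyEtale_normalizationInι` — the packaged form used at 4.16.

## Sources

* A. J. de Jong, *Smoothness, semi-stability and alterations*, Publ. Math. IHÉS 83 (1996) 51–93:
  2.6 (p. 55), 2.20 (p. 61), 4.16 (p. 71).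
* Q. Liu, *Algebraic Geometry and Arithmetic Curves*, OUP (2002), Def. 4.1.24, Prop. 4.1.27.
-/

noncomputable section

open CategoryTheory AlgebraicGeometry TopologicalSpace Topology

namespace Literature.AlgebraicGeometry.Resolution

universe u

section NormalizationInSeparable

variable (Y : Scheme.{u}) [IsIntegral Y] (L : Type u) [Field L] [Algebra Y.functionField L]

/-- `Y^L → Y` is surjective: it is integral, hence closed, and dominant. [folklore] -/
theorem surjective_normalizationInι : Surjective (normalizationInι Y L) := by
  refine ⟨fun y => ?_⟩
  have hcl : IsClosed (Set.range (normalizationInι Y L)) :=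
    (normalizationInι Y L).isClosedMap.isClosed_range
  have hd : Dense (Set.range (normalizationInι Y L)) := (normalizationInι Y L).denseRange
  have : Set.range (normalizationInι Y L) = Set.univ := by
    rw [← hd.closure_eq, hcl.closure_eq]
  exact Set.range_eq_univ.mp this y

/-- **The normalization of a variety in a finite separable extension of its function field is
generically étale** (de Jong 1996, 4.16 with 2.20: "`ψ : Y' → Y` is a (finite) generically
étale alteration of `Y`" — "an alteration `S' → S` is generically étale if and only if the
(finite) extension of function fields `R(S) ⊂ R(S')` is separable"; 2.6: étale on a dense open
of the source). Only "integral, locally of finite type over a field" is used for `Y`.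
[cite: DeJong1996, 4.16, p. 71] -/
theorem isGenericallyEtale_normalizationInι [FiniteDimensional Y.functionField L]
    [Algebra.IsSeparable Y.functionField L] {k : Type u} [Field k] (g : Y ⟶ Spec (.of k))
    [LocallyOfFiniteType g] : IsGenericallyEtale (normalizationInι Y L) := by
  classical
  -- a non-empty affine open `U = Spec A` of `Y`
  obtain ⟨y⟩ := (inferInstance : Nonempty Y)
  obtain ⟨_, ⟨U, hU, rfl⟩, hyU, -⟩ :=
    Y.isBasis_affineOpens.exists_subset_of_mem_open (Set.mem_univ y) isOpen_univ
  haveI : Nonempty U := ⟨⟨y, hyU⟩⟩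
  have hUne : (U : Set Y).Nonempty := ⟨y, hyU⟩
  let K : Type u := Y.functionField
  let A : Type u := Γ(Y, U)
  -- `A` is a finitely generated `k`-algebra, hence Noetherian, a domain with fraction field `K`
  let φ : k →+* A := (g.appLE ⊤ U le_top).hom.comp (Scheme.ΓSpecIso (.of k)).inv.hom
  have hφ : φ.FiniteType := by
    refine RingHom.FiniteType.comp ?_ (RingHom.FiniteType.of_surjective _
      (Scheme.ΓSpecIso (.of k)).symm.commRingCatIsoToRingEquiv.surjective)
    exact HasRingHomProperty.appLE @LocallyOfFiniteType g ‹_› ⟨⊤, isAffineOpen_top _⟩ ⟨U, hU⟩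
      le_top
  letI : Algebra k A := φ.toAlgebra
  haveI : Algebra.FiniteType k A := hφ
  haveI : IsNoetherianRing A := Algebra.FiniteType.isNoetherianRing k A
  haveI : IsFractionRing A K := functionField_isFractionRing_of_isAffineOpen Y U hU
  -- `L` as an `A`-algebra through `K`
  letI algL : Algebra A L := ((algebraMap K L).comp (Y.germToFunctionField U).hom).toAlgebra
  haveI : IsScalarTower A K L := IsScalarTower.of_algebraMap_eq fun a => rfl
  -- the integral closure `C₀` of `A` in `L`: a finite `A`-module, a domain with fraction field `L`
  let C₀ : Type u := integralClosure A L
  haveI : Module.Finite A C₀ := NoetherFiniteIntegralClosure_holds k A K L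
  haveI : IsFractionRing C₀ L := integralClosure.isFractionRing_of_finite_extension K L
  obtain ⟨c, hc0, hc⟩ := exists_etale_localization_away_of_isSeparable_of_finite A C₀ K L
  -- the chart `Spec C → Y^L` of the normalization over `U`, `C` the integral closure of `A` in
  -- `Γ(Spec L, ξ_L⁻¹ U) ≅ L`
  letI algS := ((fromSpecExtension Y L).app U).hom.toAlgebra
  let S : Type u := Γ(Spec (.of L), fromSpecExtension Y L ⁻¹ᵁ U)
  let e : L ≃ₐ[A] S :=
    { (extensionIsoSections (X := Y) (L := L) hUne).commRingCatIsoToRingEquiv with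
      commutes' := fun a => (fromSpecExtension_app_apply (X := Y) (L := L) hUne a).symm }
  let C : Type u := integralClosure A S
  -- `ε : C ≃ₐ[A] C₀`
  let ε : C ≃ₐ[A] C₀ :=
    ((integralClosure A S).equivMapOfInjective e.symm.toAlgHom e.symm.injective).trans
      (Subalgebra.equivOfEq _ _ (integralClosure_map_algEquiv e.symm))
  -- the open immersion `w : Spec C₀[1/c] → Spec C₀ ≅ Spec C → Y^L`
  let chart : Spec (.of C) ⟶ normalizationIn Y L :=
    (fromSpecExtension Y L).normalizationOpenCover.f ⟨U, hU⟩
  haveI : IsOpenImmersion chart := inferInstanceAs (IsOpenImmersion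
    ((fromSpecExtension Y L).normalizationOpenCover.f ⟨U, hU⟩))
  have hchart : chart ≫ normalizationInι Y L =
      Spec.map (CommRingCat.ofHom (algebraMap A C)) ≫ hU.fromSpec :=
    (fromSpecExtension Y L).ι_fromNormalization ⟨U, hU⟩
  let locι : Spec (.of (Localization.Away c)) ⟶ Spec (.of C₀) :=
    Spec.map (CommRingCat.ofHom (algebraMap C₀ (Localization.Away c)))
  haveI : IsOpenImmersion locι := IsOpenImmersion.of_isLocalization c
  let ει : Spec (.of C₀) ⟶ Spec (.of C) := Spec.map (CommRingCat.ofHom ε.toAlgHom.toRingHom)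
  haveI : IsIso (CommRingCat.ofHom ε.toAlgHom.toRingHom) :=
    ε.toRingEquiv.toCommRingCatIso.isIso_hom
  haveI : IsOpenImmersion ει :=
    inferInstanceAs (IsOpenImmersion (Spec.map (CommRingCat.ofHom ε.toAlgHom.toRingHom)))
  let w : Spec (.of (Localization.Away c)) ⟶ normalizationIn Y L := locι ≫ ει ≫ chart
  haveI : IsOpenImmersion w := inferInstanceAs (IsOpenImmersion (locι ≫ ει ≫ chart))
  -- `w ≫ ψ = Spec (A → C₀[1/c]) ≫ (Spec A ≅ U ⊆ Y)` is étale
  have hw : w ≫ normalizationInι Y L =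
      Spec.map (CommRingCat.ofHom (algebraMap A (Localization.Away c))) ≫ hU.fromSpec := by
    have e1 : w ≫ normalizationInι Y L = locι ≫ ει ≫ (chart ≫ normalizationInι Y L) := by
      simp only [w, Category.assoc]
    rw [e1, hchart]
    simp only [locι, ει, ← Spec.map_comp_assoc]
    have e2 : (CommRingCat.ofHom (algebraMap A C) ≫ CommRingCat.ofHom ε.toAlgHom.toRingHom) ≫
          CommRingCat.ofHom (algebraMap C₀ (Localization.Away c)) =
        CommRingCat.ofHom (algebraMap A (Localization.Away c)) := by
      ext a
      change algebraMap C₀ (Localization.Away c) (ε (algebraMap A C a)) =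
        algebraMap A (Localization.Away c) a
      rw [AlgEquiv.commutes, ← IsScalarTower.algebraMap_apply]
    rw [e2]
  haveI hwet : Etale (w ≫ normalizationInι Y L) := by
    rw [hw]
    haveI : Etale (Spec.map (CommRingCat.ofHom (algebraMap A (Localization.Away c)))) := by
      rw [HasRingHomProperty.Spec_iff (P := @Etale), CommRingCat.hom_ofHom,
        RingHom.etale_algebraMap]
      exact hc
    infer_instance
  -- the open `w(Spec C₀[1/c])` is non-empty, hence dense in the irreducible `Y^L`
  haveI : IsDomain (Localization.Away c) :=
    IsLocalization.isDomain_localization (powers_le_nonZeroDivisors_of_noZeroDivisors hc0)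
  haveI : Nonempty ↥(Spec (.of (Localization.Away c))) :=
    inferInstanceAs (Nonempty (PrimeSpectrum (Localization.Away c)))
  refine ⟨w.opensRange, w.opensRange.2.dense ⟨w (Classical.arbitrary _), ⟨_, rfl⟩⟩, ?_⟩
  rw [← Scheme.Hom.isoOpensRange_inv_comp w, Category.assoc]
  infer_instance

/-- **de Jong 1996, 4.16: "`ψ : Y' → Y` is a (finite) generically étale alteration of `Y`"**
for `Y' = Y^L` the normalization of the variety `Y` in a finite separable extension `L` of
`k(Y)` — packaged. [cite: DeJong1996, 4.16, p. 71] -/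
theorem isAlteration_and_isGenericallyEtale_normalizationInι [FiniteDimensional Y.functionField L]
    [Algebra.IsSeparable Y.functionField L] {k : Type u} [Field k] (g : Y ⟶ Spec (.of k))
    [LocallyOfFiniteType g] :
    IsFinite (normalizationInι Y L) ∧ IsAlteration (normalizationInι Y L) ∧
      IsGenericallyEtale (normalizationInι Y L) :=
  ⟨isFinite_normalizationInι Y L g, isAlteration_normalizationInι Y L g,
    isGenericallyEtale_normalizationInι Y L g⟩

end NormalizationInSeparable

end Literature.AlgebraicGeometry.Resolution

end
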